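import Summits.Ventures.DiscreteObjects.Hadamard.FixedStructure

/-!
# Hadamard 668 census, family F12 — no automorphism of order 17, 19, 31, 47 (kernel; no parity theorem)

Framing: lottery ticket; floor = certified bounds/negative ranges.

Cell pub-namedobj (venture DiscreteObjects), target (H), hadamard gen 6.  `PrimeOrderAutomorphism.no_automorphism_primes106`
excludes 106 odd primes by the orbit-row identities + Cauchy–Schwarz alone.  For `p ∈ {17, 19, 31, 47}` Cauchy–Schwarz leaves
the orbit numbers `(17; m = 37, 38, 39)`, `(19; 34, 35)`, `(31; 21)`, `(47; 14)` (`cs17`, `cs19`, `cs31`, `cs47`, `decide`); the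
census (FAMILY-F12-G5 §9) removed them with Lander's parity theorem and a fixed-point 'pair arithmetic' on paper.  Here it is
done INSIDE THE KERNEL with the lemmas of `FixedStructure`, for a `0/1` incidence function `N : P → B → ℤ` with
`|P| = |B| = 667`, row sums `333`, distinct-row inner products `166` (for `p = 17` also the same for columns), and an
automorphism pair `(ρ, τ)` with `ρ^p = τ^p = 1`, `ρ ≠ 1`:
* `p = 31`: `m = 21`, 16 fixed blocks; a fixed point (exists: `#fixed ≡ 667 ≡ 16 (mod 31)`) would lie on `c ≡ 333 ≡ 23 (mod 31)`
  fixed blocks, `c ≤ 16`: impossible;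
* `p = 47`: `m = 14`, 9 fixed blocks, `c = 4`; two fixed points (`#fixed ≡ 9 (mod 47)`) share `u ≡ 166 ≡ 25 (mod 47)`, `u ≤ 4`;
* `p = 19`: `m = 35`: 2 fixed blocks, `c ≡ 10 (mod 19)`; `m = 34`: 21 fixed blocks, `c = 10`, `u ≡ 14 (mod 19) ≤ 10`;
* `p = 17`: `m ∈ {37, 38, 39}` on BOTH sides (dual structure `N' y x = N x y`); 4 or 21 fixed elements die as above
  (`c ≡ 10`, `u ≡ 13 (mod 17)`, `side17`); with 38 fixed points and 38 fixed blocks every fixed point lies on exactly 27 fixed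
  blocks, every fixed block contains exactly 27 fixed points, every two fixed points share exactly 13 fixed blocks, and counting
  `Σ_{x' fixed} Σ_{y fixed} N x y N x' y` two ways gives `27 · 27 = 27 + 37 · 13`: contradiction.
MAIN: `no_automorphism_17_19_31_47`.  With p232555 the kernel now excludes 110 of the 111 odd primes `p ≤ 661` outside
`{3,5,7,11,13,23,37,41,83}`; the single remaining paper step of the census line is Lander's parity theorem for
`(29; 23 orbits, fixed-point-free)` — `(29, 22)` already has negative Cauchy–Schwarz discriminant.  Ours; no `sorry`.
-/

open Finset BigOperators

namespace Summit.Ventures.DiscreteObjects.Hadamard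

section primes
variable {P B : Type*} [Fintype P] [DecidableEq P] [Fintype B] [DecidableEq B]

/-- Cauchy–Schwarz versus a negative discriminant: no real `σ` -/
lemma cs_contra (m p σ : ℤ) (cs : (333 - σ) ^ 2 ≤ m * (167 + 166 * p - p * σ))
    (hd : 0 < 4 * (333 ^ 2 - m * (167 + 166 * p)) - (666 - m * p) ^ 2) : False := by
  nlinarith [sq_nonneg (2 * σ - (666 - m * p)), cs, hd]

set_option maxRecDepth 100000 in
/-- `p = 31`: every orbit number except `21` has negative discriminant -/
lemma cs31 : ∀ m ∈ Finset.range 22, 1 ≤ m → m ≠ 21 →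
    (0 : ℤ) < 4 * (333 ^ 2 - (m : ℤ) * (167 + 166 * 31)) - (666 - (m : ℤ) * 31) ^ 2 := by decide

set_option maxRecDepth 100000 in
/-- `p = 47`: every orbit number except `14` has negative discriminant -/
lemma cs47 : ∀ m ∈ Finset.range 15, 1 ≤ m → m ≠ 14 →
    (0 : ℤ) < 4 * (333 ^ 2 - (m : ℤ) * (167 + 166 * 47)) - (666 - (m : ℤ) * 47) ^ 2 := by decide

set_option maxRecDepth 100000 in
/-- `p = 19`: every orbit number except `34, 35` has negative discriminant -/
lemma cs19 : ∀ m ∈ Finset.range 36, 1 ≤ m → m ≠ 34 → m ≠ 35 →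
    (0 : ℤ) < 4 * (333 ^ 2 - (m : ℤ) * (167 + 166 * 19)) - (666 - (m : ℤ) * 19) ^ 2 := by decide

set_option maxRecDepth 100000 in
/-- `p = 17`: every orbit number except `37, 38, 39` has negative discriminant -/
lemma cs17 : ∀ m ∈ Finset.range 40, 1 ≤ m → m ≠ 37 → m ≠ 38 → m ≠ 39 →
    (0 : ℤ) < 4 * (333 ^ 2 - (m : ℤ) * (167 + 166 * 17)) - (666 - (m : ℤ) * 17) ^ 2 := by decide

/-- **No automorphism of order 31** (`m = 21`, 16 fixed blocks; a fixed point would lie on `c ≡ 23 (mod 31)` of them). -/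
theorem no_automorphism_31 (N : P → B → ℤ) (h01 : ∀ x y, N x y = 0 ∨ N x y = 1)
    (hrow : ∀ x, ∑ y, N x y = 333) (hpair : ∀ x x', x ≠ x' → ∑ y, N x y * N x' y = 166)
    (hP : Fintype.card P = 667) (hB : Fintype.card B = 667)
    (ρ : Equiv.Perm P) (τ : Equiv.Perm B) (hN : ∀ x y, N (ρ x) (τ y) = N x y)
    (hρ : ρ ^ 31 = 1) (hτ : τ ^ 31 = 1) (x₀ : P) (hx₀ : ρ x₀ ≠ x₀) : False := by
  have hp : (31 : ℕ).Prime := by norm_num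
  obtain ⟨hm1, σ, cs⟩ := orbitCount_cs N h01 hrow hpair 31 hp ρ τ hN hρ hτ x₀ hx₀
  have hcnt := card_fixed_add_classes τ hp hτ
  rw [hB] at hcnt
  set m := (blockClasses τ 31).card with hmdef
  have hm21 : m = 21 := by
    by_contra hne
    exact cs_contra m 31 σ (by exact_mod_cast cs) (cs31 m (Finset.mem_range.mpr (by omega)) hm1 hne)
  have hF : (univ.filter fun y => τ y = y).card = 16 := by omega
  have hfp := card_fixed_mod ρ hp hρ
  rw [hP] at hfp
  obtain ⟨x, hx⟩ : (univ.filter fun x => ρ x = x).Nonempty := Finset.card_pos.mp (by omega)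
  have hxfix : ρ x = x := (Finset.mem_filter.mp hx).2
  obtain ⟨a, ha⟩ := fixedPoint_row N hrow hp ρ τ hN hτ hxfix
  obtain ⟨c0, c1⟩ := fixedCount_bounds N h01 τ x
  rw [hF] at c1
  push_cast at ha c1
  omega

/-- **No automorphism of order 47** (`m = 14`, 9 fixed blocks, `c = 4`; two fixed points would share `u ≡ 25 (mod 47)`). -/
theorem no_automorphism_47 (N : P → B → ℤ) (h01 : ∀ x y, N x y = 0 ∨ N x y = 1)
    (hrow : ∀ x, ∑ y, N x y = 333) (hpair : ∀ x x', x ≠ x' → ∑ y, N x y * N x' y = 166)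
    (hP : Fintype.card P = 667) (hB : Fintype.card B = 667)
    (ρ : Equiv.Perm P) (τ : Equiv.Perm B) (hN : ∀ x y, N (ρ x) (τ y) = N x y)
    (hρ : ρ ^ 47 = 1) (hτ : τ ^ 47 = 1) (x₀ : P) (hx₀ : ρ x₀ ≠ x₀) : False := by
  have hp : (47 : ℕ).Prime := by norm_num
  obtain ⟨hm1, σ, cs⟩ := orbitCount_cs N h01 hrow hpair 47 hp ρ τ hN hρ hτ x₀ hx₀
  have hcnt := card_fixed_add_classes τ hp hτ
  rw [hB] at hcnt
  set m := (blockClasses τ 47).card with hmdef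
  have hm14 : m = 14 := by
    by_contra hne
    exact cs_contra m 47 σ (by exact_mod_cast cs) (cs47 m (Finset.mem_range.mpr (by omega)) hm1 hne)
  have hF : (univ.filter fun y => τ y = y).card = 9 := by omega
  have hfp := card_fixed_mod ρ hp hρ
  rw [hP] at hfp
  obtain ⟨x, hx, x', hx', hxx'⟩ := Finset.one_lt_card.mp
    (show 1 < (univ.filter fun x => ρ x = x).card by omega)
  have hxfix : ρ x = x := (Finset.mem_filter.mp hx).2
  have hx'fix : ρ x' = x' := (Finset.mem_filter.mp hx').2
  obtain ⟨a, ha⟩ := fixedPoint_row N hrow hp ρ τ hN hτ hxfix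
  obtain ⟨c0, c1⟩ := fixedCount_bounds N h01 τ x
  obtain ⟨t, ht⟩ := fixedPair N hp ρ τ hN hτ hxfix hx'fix (hpair x x' hxx')
  obtain ⟨u0, u1⟩ := pairCount_bounds N h01 τ x x'
  rw [hF] at c1
  push_cast at ha c1 ht
  omega

/-- **No automorphism of order 19** (`m ∈ {34, 35}`: 21 fixed blocks, `c = 10`, `u ≡ 14 (mod 19)`; or 2 fixed blocks, `c ≡ 10`). -/
theorem no_automorphism_19 (N : P → B → ℤ) (h01 : ∀ x y, N x y = 0 ∨ N x y = 1)
    (hrow : ∀ x, ∑ y, N x y = 333) (hpair : ∀ x x', x ≠ x' → ∑ y, N x y * N x' y = 166)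
    (hP : Fintype.card P = 667) (hB : Fintype.card B = 667)
    (ρ : Equiv.Perm P) (τ : Equiv.Perm B) (hN : ∀ x y, N (ρ x) (τ y) = N x y)
    (hρ : ρ ^ 19 = 1) (hτ : τ ^ 19 = 1) (x₀ : P) (hx₀ : ρ x₀ ≠ x₀) : False := by
  have hp : (19 : ℕ).Prime := by norm_num
  obtain ⟨hm1, σ, cs⟩ := orbitCount_cs N h01 hrow hpair 19 hp ρ τ hN hρ hτ x₀ hx₀
  have hcnt := card_fixed_add_classes τ hp hτ
  rw [hB] at hcnt
  set m := (blockClasses τ 19).card with hmdef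
  have hm : m = 34 ∨ m = 35 := by
    by_contra hne
    exact cs_contra m 19 σ (by exact_mod_cast cs)
      (cs19 m (Finset.mem_range.mpr (by omega)) hm1 (fun h => hne (Or.inl h)) (fun h => hne (Or.inr h)))
  have hfp := card_fixed_mod ρ hp hρ
  rw [hP] at hfp
  obtain ⟨x, hx, x', hx', hxx'⟩ := Finset.one_lt_card.mp
    (show 1 < (univ.filter fun x => ρ x = x).card by omega)
  have hxfix : ρ x = x := (Finset.mem_filter.mp hx).2
  have hx'fix : ρ x' = x' := (Finset.mem_filter.mp hx').2
  obtain ⟨a, ha⟩ := fixedPoint_row N hrow hp ρ τ hN hτ hxfix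
  obtain ⟨c0, c1⟩ := fixedCount_bounds N h01 τ x
  obtain ⟨t, ht⟩ := fixedPair N hp ρ τ hN hτ hxfix hx'fix (hpair x x' hxx')
  obtain ⟨u0, u1⟩ := pairCount_bounds N h01 τ x x'
  push_cast at ha c1 ht
  rcases hm with h | h
  · have hF : (univ.filter fun y => τ y = y).card = 21 := by omega
    rw [hF] at c1; push_cast at c1
    omega
  · have hF : (univ.filter fun y => τ y = y).card = 2 := by omega
    rw [hF] at c1; push_cast at c1
    omega

omit [Fintype P] [DecidableEq P] in
/-- `p = 17`, one side: with `F ∈ {4, 21, 38}` fixed blocks and two distinct `ρ`-fixed points available, only `F = 38` survives,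
and then every fixed point lies on exactly `27` fixed blocks and every two on exactly `13` common ones. -/
lemma side17 (N : P → B → ℤ) (h01 : ∀ x y, N x y = 0 ∨ N x y = 1)
    (hrow : ∀ x, ∑ y, N x y = 333) (hpair : ∀ x x', x ≠ x' → ∑ y, N x y * N x' y = 166)
    (ρ : Equiv.Perm P) (τ : Equiv.Perm B) (hN : ∀ x y, N (ρ x) (τ y) = N x y) (hτ : τ ^ 17 = 1)
    (hF : (univ.filter fun y => τ y = y).card = 4 ∨ (univ.filter fun y => τ y = y).card = 21 ∨
      (univ.filter fun y => τ y = y).card = 38)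
    {x x' : P} (hx : ρ x = x) (hx' : ρ x' = x') (hxx' : x ≠ x') :
    (univ.filter fun y => τ y = y).card = 38 ∧ ∑ y ∈ univ.filter (fun y => τ y = y), N x y = 27 ∧
      ∑ y ∈ univ.filter (fun y => τ y = y), N x y * N x' y = 13 := by
  have hp : (17 : ℕ).Prime := by norm_num
  obtain ⟨a, ha⟩ := fixedPoint_row N hrow hp ρ τ hN hτ hx
  obtain ⟨c0, c1⟩ := fixedCount_bounds N h01 τ x
  obtain ⟨t, ht⟩ := fixedPair N hp ρ τ hN hτ hx hx' (hpair x x' hxx')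
  obtain ⟨u0, u1⟩ := pairCount_bounds N h01 τ x x'
  push_cast at ha c1 ht
  rcases hF with h | h | h
  · rw [h] at c1; push_cast at c1; omega
  · rw [h] at c1; push_cast at c1; omega
  · rw [h] at c1; push_cast at c1
    refine ⟨h, ?_, ?_⟩ <;> omega

/-- **No automorphism of order 17** (two-sided hypotheses: the dual count is needed when both sides have 38 fixed elements). -/
theorem no_automorphism_17 (N : P → B → ℤ) (h01 : ∀ x y, N x y = 0 ∨ N x y = 1)
    (hrow : ∀ x, ∑ y, N x y = 333) (hpair : ∀ x x', x ≠ x' → ∑ y, N x y * N x' y = 166)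
    (hcol : ∀ y, ∑ x, N x y = 333) (hcpair : ∀ y y', y ≠ y' → ∑ x, N x y * N x y' = 166)
    (hP : Fintype.card P = 667) (hB : Fintype.card B = 667)
    (ρ : Equiv.Perm P) (τ : Equiv.Perm B) (hN : ∀ x y, N (ρ x) (τ y) = N x y)
    (hρ : ρ ^ 17 = 1) (hτ : τ ^ 17 = 1) (x₀ : P) (hx₀ : ρ x₀ ≠ x₀) : False := by
  have hp : (17 : ℕ).Prime := by norm_num
  -- block side: number of τ-classes
  obtain ⟨hm1, σ, cs⟩ := orbitCount_cs N h01 hrow hpair 17 hp ρ τ hN hρ hτ x₀ hx₀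
  have hcnt := card_fixed_add_classes τ hp hτ
  rw [hB] at hcnt
  set m := (blockClasses τ 17).card with hmdef
  have hm : m = 37 ∨ m = 38 ∨ m = 39 := by
    by_contra hne
    exact cs_contra m 17 σ (by exact_mod_cast cs) (cs17 m (Finset.mem_range.mpr (by omega)) hm1
      (fun h => hne (Or.inl h)) (fun h => hne (Or.inr (Or.inl h))) (fun h => hne (Or.inr (Or.inr h))))
  have hFB : (univ.filter fun y => τ y = y).card = 4 ∨ (univ.filter fun y => τ y = y).card = 21 ∨
      (univ.filter fun y => τ y = y).card = 38 := by omega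
  -- point side via the dual structure
  let N' : B → P → ℤ := fun y x => N x y
  have h01' : ∀ y x, N' y x = 0 ∨ N' y x = 1 := fun y x => h01 x y
  have hN' : ∀ y x, N' (τ y) (ρ x) = N' y x := fun y x => hN x y
  obtain ⟨y₀, hy₀⟩ := exists_moved_block N h01 hrow hpair ρ τ hN hx₀
  obtain ⟨hm1', σ', cs'⟩ := orbitCount_cs N' h01' hcol hcpair 17 hp τ ρ hN' hτ hρ y₀ hy₀
  have hcnt' := card_fixed_add_classes ρ hp hρ
  rw [hP] at hcnt'
  set m' := (blockClasses ρ 17).card with hm'def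
  have hm' : m' = 37 ∨ m' = 38 ∨ m' = 39 := by
    by_contra hne
    exact cs_contra m' 17 σ' (by exact_mod_cast cs') (cs17 m' (Finset.mem_range.mpr (by omega)) hm1'
      (fun h => hne (Or.inl h)) (fun h => hne (Or.inr (Or.inl h))) (fun h => hne (Or.inr (Or.inr h))))
  have hFP : (univ.filter fun x => ρ x = x).card = 4 ∨ (univ.filter fun x => ρ x = x).card = 21 ∨
      (univ.filter fun x => ρ x = x).card = 38 := by omega
  -- two fixed points and two fixed blocks
  obtain ⟨x, hx, x', hx', hxx'⟩ := Finset.one_lt_card.mp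
    (show 1 < (univ.filter fun x => ρ x = x).card by omega)
  obtain ⟨y, hy, y', hy', hyy'⟩ := Finset.one_lt_card.mp
    (show 1 < (univ.filter fun y => τ y = y).card by omega)
  have hxfix : ρ x = x := (Finset.mem_filter.mp hx).2
  have hx'fix : ρ x' = x' := (Finset.mem_filter.mp hx').2
  have hyfix : τ y = y := (Finset.mem_filter.mp hy).2
  have hy'fix : τ y' = y' := (Finset.mem_filter.mp hy').2
  -- both sides have 38 fixed elements; c = 27 everywhere, u = 13 for all pairs
  obtain ⟨hFB38, -, -⟩ := side17 N h01 hrow hpair ρ τ hN hτ hFB hxfix hx'fix hxx'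
  obtain ⟨hFP38, -, -⟩ := side17 N' h01' hcol hcpair τ ρ hN' hρ hFP hyfix hy'fix hyy'
  set FP := univ.filter fun x => ρ x = x with hFPdef
  set FB := univ.filter fun y => τ y = y with hFBdef
  have hc : ∀ z ∈ FP, ∑ w ∈ FB, N z w = 27 := by
    intro z hz
    -- pair z with a different fixed point
    obtain ⟨z', hz', hzz'⟩ : ∃ z' ∈ FP, z' ≠ z := by
      by_cases h : z = x
      · exact ⟨x', hx', fun e => hxx' (e.trans h).symm⟩
      · exact ⟨x, hx, fun e => h e.symm⟩
    exact (side17 N h01 hrow hpair ρ τ hN hτ hFB (Finset.mem_filter.mp hz).2 (Finset.mem_filter.mp hz').2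
      hzz'.symm).2.1
  have hu : ∀ z ∈ FP, ∀ z' ∈ FP, z ≠ z' → ∑ w ∈ FB, N z w * N z' w = 13 := by
    intro z hz z' hz' hzz'
    exact (side17 N h01 hrow hpair ρ τ hN hτ hFB (Finset.mem_filter.mp hz).2 (Finset.mem_filter.mp hz').2
      hzz').2.2
  have hc' : ∀ w ∈ FB, ∑ z ∈ FP, N z w = 27 := by
    intro w hw
    obtain ⟨w', hw', hww'⟩ : ∃ w' ∈ FB, w' ≠ w := by
      by_cases h : w = y
      · exact ⟨y', hy', fun e => hyy' (e.trans h).symm⟩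
      · exact ⟨y, hy, fun e => h e.symm⟩
    exact (side17 N' h01' hcol hcpair τ ρ hN' hρ hFP (Finset.mem_filter.mp hw).2 (Finset.mem_filter.mp hw').2
      hww'.symm).2.1
  -- the count Σ_{z' ∈ FP} u(x, z') two ways
  have way1 : ∑ z' ∈ FP, ∑ w ∈ FB, N x w * N z' w = 27 * 27 := by
    rw [Finset.sum_comm]
    have : ∀ w ∈ FB, ∑ z' ∈ FP, N x w * N z' w = N x w * 27 := by
      intro w hw
      rw [← Finset.mul_sum, hc' w hw]
    rw [Finset.sum_congr rfl this, ← Finset.sum_mul, hc x hx]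
  have way2 : ∑ z' ∈ FP, ∑ w ∈ FB, N x w * N z' w = 27 + 37 * 13 := by
    rw [← Finset.add_sum_erase FP _ hx]
    have hself : ∑ w ∈ FB, N x w * N x w = 27 := by
      rw [Finset.sum_congr rfl (fun w _ => show N x w * N x w = N x w by
        rcases h01 x w with h | h <;> simp [h]), hc x hx]
    have hrest : ∀ z' ∈ FP.erase x, ∑ w ∈ FB, N x w * N z' w = 13 :=
      fun z' hz' => hu x hx z' (Finset.mem_of_mem_erase hz') (Finset.ne_of_mem_erase hz').symm
    rw [hself, Finset.sum_congr rfl hrest, Finset.sum_const, Finset.card_erase_of_mem hx, hFP38]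
    norm_num
  rw [way1] at way2
  norm_num at way2

/-- **Main theorem of this file.** For `p ∈ {17, 19, 31, 47}` a `0/1` incidence function with `|P| = |B| = 667`, row and
column sums `333`, inner products `166` of distinct rows and of distinct columns, admits no automorphism pair `(ρ, τ)`
with `ρ^p = τ^p = 1`, `ρ ≠ 1` — all in the kernel, no parity theorem. -/
theorem no_automorphism_17_19_31_47 (N : P → B → ℤ) (h01 : ∀ x y, N x y = 0 ∨ N x y = 1)
    (hrow : ∀ x, ∑ y, N x y = 333) (hpair : ∀ x x', x ≠ x' → ∑ y, N x y * N x' y = 166)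
    (hcol : ∀ y, ∑ x, N x y = 333) (hcpair : ∀ y y', y ≠ y' → ∑ x, N x y * N x y' = 166)
    (hP : Fintype.card P = 667) (hB : Fintype.card B = 667)
    (p : ℕ) (hmem : p = 17 ∨ p = 19 ∨ p = 31 ∨ p = 47)
    (ρ : Equiv.Perm P) (τ : Equiv.Perm B) (hN : ∀ x y, N (ρ x) (τ y) = N x y)
    (hρ : ρ ^ p = 1) (hτ : τ ^ p = 1) (x₀ : P) (hx₀ : ρ x₀ ≠ x₀) : False := by
  rcases hmem with rfl | rfl | rfl | rfl
  · exact no_automorphism_17 N h01 hrow hpair hcol hcpair hP hB ρ τ hN hρ hτ x₀ hx₀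
  · exact no_automorphism_19 N h01 hrow hpair hP hB ρ τ hN hρ hτ x₀ hx₀
  · exact no_automorphism_31 N h01 hrow hpair hP hB ρ τ hN hρ hτ x₀ hx₀
  · exact no_automorphism_47 N h01 hrow hpair hP hB ρ τ hN hρ hτ x₀ hx₀

end primes

end Summit.Ventures.DiscreteObjects.Hadamard
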